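import Summits.BirchSwinnertonDyer.BirchSwinnertonDyer.Theorems.EisensteinPrimesBSDpOnCellCReorientedPNew
import Summits.BirchSwinnertonDyer.BirchSwinnertonDyer.Theorems.UniversalToricDescentTwinTorsionRankOneK
import Summits.BirchSwinnertonDyer.Rank1Residual.X2.NonsplitControlLinks
import Summits.BirchSwinnertonDyer.Rank1Residual.X2.RankOneLinks
import Literature.NumberTheory.EllipticCurves.LeadingTermProofs
import HarnessLib

/-!
# Crux 3 `MazurMCOnCellB` (stmt-BirchSwinnertonDyer-19033), line `twistback` (registered v2, 16048b05…), stub 3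
# `stub_kRankOne` = item -27489 `HeegnerIndexIdentityKRankOne`: the Heegner-index identity over `K` at an ODD
# MULTIPLICATIVE Eisenstein prime FROM KELLER–YIN THM. D BY NAME — rank-AGNOSTIC (`r_an(E/K) = 1`, either
# orientation), SIGN-FREE, pointwise at a Heegner datum (cell `bsd-eis`, LEAD bsd-line-x2-p1 g8)

HONEST FRAMING (cell `bsd-eis`, run/shared/lean/pub/bsd-eis/): theorems only; nothing booked; X2 stays
CONSTRUCTION-SHAPED; no label or count moves; BSD / Mazur's main conjecture is proved for NO curve here.
Every theorem is CONDITIONAL on its displayed binders, in particular on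
`KellerYin2024.thmD_imcMult_exists_isBDPLFunction_isTorsion_charIdeal_eq_OPEN` (Keller–Yin arXiv:2402.12781v2
Thm. D = Thm. 5.1.3, UNREFEREED PREPRINT, printed proof gapped at L1754 — flag `KYD-gap`), taken BY NAME.

## What this file proves (numbers, not adjectives)

Crux 4's pointwise road `Reoriented.bsdp_of_cellC_of_{not_split,split}_of_manin_of_pNewValue_of_imcIntOther`
(cgshw g12, `…BSDpOnCellCReorientedPNew`) derives `BSD(E,p)` at a RANK-ONE X2 pair from Thm. D's IMC atom +
the anticyclotomic control theorem + the BDP value at `𝟙`, passing THROUGH the Heegner-index identity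
`X11b.IndexIdentityAt W p K P` (`X2.indexIdentityAt_of_shadowLinks`). Its only uses of `ord_{s=1} L(E,s) = 1`
before that point are (a) `rank E(K) = 1`, `Ш(E/K)` finite and (b) `P_K` non-torsion. Both hold on the whole
locus `ord_{s=1} L(E/K, s) = 1` = «`r_an(E) + r_an(E^{(d_K)}) = 1`», i.e. in EITHER rank orientation
(`UniversalToricDescentTwinTorsionRankOneK.mordellWeilRank_eq_one_and_shaFinite_of_analyticRankEK_eq_one`;
Gross–Zagier), and the control theorem is typed on exactly those inputs, both signs at `p`
(`JSWControl.controlOnTreeAt_of_mult_of_rankOne_shaPrimary`, bsd-stepL). Hence: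

* §0 `exists_point_map_embedding_eq` — bookkeeping: a `K`-point read through ANY `ι : K →+* ℂ` as the
  Heegner point is, after an automorphism of the quadratic field `K`, a `K`-point read through the
  embedding of any infinite place, with the SAME index `[E(K) : ℤ·P]` (the printed value fact is typed with
  an infinite place).
* §1 `shaFinite_and_indexIdentityAt_of_thmD_OPEN_of_bdpValue` — THE CORE, sign-free and rank-agnostic: at a
  datum (`W` globally minimal, `p` odd multiplicative with `E[p]` reducible, `K` imaginary quadratic with
  `d_K` odd `< -4` and Heegner for `N_E`, `Dt` with `p ∤ c(Dt)`, `P` its Heegner point through an infinite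
  place, `r_an(E) + r_an(E^{(d_K)}) = 1`): Thm. D BY NAME + the two Poitou–Tate facts + Hsieh 2014 Thm. 1
  + Gross–Zagier + GZK + newforms + the BDP VALUE AT `𝟙` for every ♭-frame (hypothesis `hval`, the body of
  crux 4's `X2.NonsplitBDPValueOnTreeInt` at this datum) ⟹ `Ш(E/K)` finite ∧ `X11b.IndexIdentityAt W p K P`.
* §2 `bdpValueAtOneIntAt_of_bdpDisplay_pNew` — the value hypothesis FROM PRINT at `p ≥ 5`
  ([cas-split] = Castella JIMJ 17 (2018) Thms. 2.10–2.11, tree fact `thm210_thm211_bdpDisplay_pNew`, PUB;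
  the 20-line block of crux 4's road, rank-free).
* §3 `shaFinite_and_indexIdentityAt_of_thmD_OPEN_pNew` / `indexIdentityAt_of_thmD_OPEN_pNew` — `p ≥ 5`:
  the identity from Thm. D + PUB facts, through an infinite place / through ANY `ι` (the binder shape of
  item -27489 plus `5 ≤ p`).

So the `K`-level content of stub 3 (both orientations) is, at `p ≥ 5`, Keller–Yin Thm. D + PUBLISHED facts;
at `p = 3` it is Thm. D + the BDP-value atom (crux 4's registered `stub_c2` content, not in print at `3 ‖ N`).
The by-name corollaries (item -27489, crux 3) live in the companion `…TwistbackThmDByName` (it imports the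
route file; this file does not — theses-cone rule).

References: [KellerYin2024] Thm. D = Thm. 5.1.3 (arXiv:2402.12781v2 L306–L309, L1725–L1780; PRE);
[Castella2018Exceptional] Thms. 2.10–2.11; [Castella2018] Thm. 2.3, §5 (5.1)–(5.3); [JetchevSkinnerWan2017]
Thm. 3.3.1, §7.4.1; [Hsieh2014] Thm. 1; [GrossZagier1986] I.§7, Thm. I.6.3, V.§2; [CastellaEtAl2021] Thm. 5.3.1.
-/

set_option autoImplicit false
set_option linter.dupNamespace false

noncomputable section

open scoped Classical MatrixGroups ModularForm Topology

open Filter CongruenceSubgroup WeierstrassCurve NumberField IsDedekindDomain Field PowerSeries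
  Literature.NumberTheory.EllipticCurves Literature.NumberTheory.EllipticCurves.GreenbergSelmer
  Literature.NumberTheory.EllipticCurves.ModularForms Literature.NumberTheory.QuadraticFields
  Literature.NumberTheory.EllipticCurves.Rank1Residual
  Literature.NumberTheory.EllipticCurves.Rank1Residual.Typed
  Literature.NumberTheory.EllipticCurves.KrizLi2019
  Literature.NumberTheory.EllipticCurves.GreenbergVatsal2000
  Literature.NumberTheory.EllipticCurves.Wuthrich2014
  Literature.NumberTheory.EllipticCurves.SteinWuthrich2013
  Literature.NumberTheory.EllipticCurves.Castella2018
  Literature.NumberTheory.EllipticCurves.Castella2018Exceptional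
  Literature.NumberTheory.GaloisRepresentations Literature.NumberTheory.GaloisCohomology
  Literature.NumberTheory.Automorphic
  Summit.BirchSwinnertonDyer.Rank1Residual.X11b.AcSelmer
  Summit.BirchSwinnertonDyer.Rank1Residual.X11b.Halves
  Summit.BirchSwinnertonDyer.Rank1Residual.X11b
  Summit.BirchSwinnertonDyer.Rank1Residual.X2
  Summit.BirchSwinnertonDyer.Rank1Residual

namespace Summit.BirchSwinnertonDyer.BirchSwinnertonDyer.Theorems.EisensteinPrimesMazurMCOnCellBTwistbackThmD

/-! ## §0. Reading the Heegner point through an infinite place (bookkeeping on the quadratic field) -/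

/-- **Any complex embedding of a quadratic field is an infinite place's embedding up to `Aut(K/ℚ)`,
and the index `[E(K) : ℤ·P]` is `Aut(K/ℚ)`-invariant.** For `K` with `[K:ℚ] = 2`, `ι : K →+* ℂ`,
`w` an infinite place and `P ∈ E(K)`: there is `P' ∈ E(K)` (namely `σ_* P` with `ι = w.embedding ∘ σ`,
`σ ∈ Aut(K/ℚ)` — `LogSymmetry.exists_algEquiv_eq_comp`) with `P'` read through `w.embedding` equal to
`P` read through `ι`, and `[E(K) : ℤ·P'] = [E(K) : ℤ·P]` (`σ_*` is an involution of `E(K)`). [folklore] -/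
theorem exists_point_map_embedding_eq (W : WeierstrassCurve ℚ) {K : Type} [Field K] [NumberField K]
    (h2 : Module.finrank ℚ K = 2) (ι : K →+* ℂ) (w : InfinitePlace K)
    (P : (W.baseChange K).toAffine.Point) :
    ∃ P' : (W.baseChange K).toAffine.Point,
      WeierstrassCurve.Affine.Point.map w.embedding.toRatAlgHom P' =
          WeierstrassCurve.Affine.Point.map ι.toRatAlgHom P ∧
        (AddSubgroup.zmultiples P').index = (AddSubgroup.zmultiples P).index := by
  obtain ⟨σ, hσ⟩ := LogSymmetry.exists_algEquiv_eq_comp h2 w.embedding ι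
  set f : (W.baseChange K).toAffine.Point →+ (W.baseChange K).toAffine.Point :=
    WeierstrassCurve.Affine.Point.map (σ : K →+* K).toRatAlgHom with hf
  have hff : ∀ Q, f (f Q) = Q := by
    rintro (_ | ⟨x, y, hxy⟩)
    · rfl
    · simp only [hf, WeierstrassCurve.Affine.Point.map_some]
      congr 1 <;> exact LogSymmetry.algEquiv_apply_apply h2 σ _
  refine ⟨f P, ?_, ?_⟩
  · rw [hf, WeierstrassCurve.Affine.Point.map_map, hσ]
    congr 1
  · have hbij : Function.Bijective f :=
      Function.bijective_iff_has_inverse.mpr ⟨f, hff, hff⟩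
    rw [← AddMonoidHom.map_zmultiples, AddSubgroup.index_map_of_bijective hbij]

/-! ## §1. THE CORE: the Heegner-index identity over `K` from Thm. D BY NAME + control + the value at `𝟙` -/

/-- **The Heegner-index identity over `K` at an odd multiplicative Eisenstein prime, RANK-AGNOSTIC and
SIGN-FREE, from Keller–Yin Thm. D BY NAME.** Data: `W/ℚ` globally minimal elliptic of conductor `N`; `p`
odd, `p ‖ N` (multiplicative, EITHER sign), `E[p]` reducible; `K` imaginary quadratic, `d_K` odd `< -4`,
every `ℓ ∣ N` split in `K`; `Dt` a parametrisation datum of level `N` with `p ∤ c(Dt)`, `H` a Heegner datum,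
`P ∈ E(K)` with `P ↦ y_H` through the embedding of the infinite place `w`; `r_an(E) + r_an(E^{(d_K)}) = 1`
(EITHER orientation). Named inputs: newforms (`hnf`), Poitou–Tate ×2 (`hPT`, `hPT2`), Hsieh 2014 Thm. 1
(`hH`), Gross–Zagier at `(N, W, K)` (`hGZ`), GZK (`hGZK`), **Thm. D** (`hD`, PRE), and the BDP VALUE AT `𝟙`
for every ♭-frame at every degree-one `𝔭 ∣ p` (`hval` — crux 4's value atom at this datum: PUB shape at
`p ≥ 5`, §2; not in print at `p = 3`). Conclusion: `Ш(E/K)` is finite and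
`2·ord_p ∏_ℓ c_ℓ(E/ℚ) + ord_p #Ш(E/K) = 2·ord_p [E(K) : ℤ·P]` (`X11b.IndexIdentityAt W p K P`).
Proof = crux 4's road re-keyed: `ord L(E/K) = 1` (`analyticRankEK_eq_add_of`) ⟹ `rank E(K) = 1`, `Ш(E/K)`
finite (GZK both factors), `P` non-torsion (Gross–Zagier); two degree-one primes `𝔭 ≠ 𝔭̄`; Hsieh's ♭-frame
`Q` at `(ι′, 𝔭)`; Thm. D ⟹ `Ch_Λ(X_ac^∅ strict at 𝔭̄)·𝓞_{ℂ_p}⟦T⟧ = (Q)` (`imcEqIntAt_other_of_thmD_OPEN`);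
`hval` ⟹ `Q(𝟙) = u·((1 − a_p p⁻¹) log_𝔭 P)²`; control at `𝔭̄` on `(rank E(K) = 1, Ш[p^∞] finite)`
(`JSWControl.controlOnTreeAt_of_mult_of_rankOne_shaPrimary`, both signs); `ord_p log_𝔭 P = ord_p log_𝔭̄ P`
(`LogSymmetry.padicLogOrd_eq_of_finrank_eq_two`); composite ⟹ shadow links ⟹ identity
(`X2.exists_shadowLinks_of_onTree_of_heegner`, `X2.indexIdentityAt_of_shadowLinks`, Tamagawa transport
`padicValNat_tamagawaProduct_baseChange_of_heegner_odd`). CONDITIONAL on every listed binder; nothing booked.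
[claim: KellerYin2024, status: under-review]
[cite: KellerYin2024, Thm. D = Thm. 5.1.3 (arXiv:2402.12781v2 L306–L309, L1725–L1780)]
[cite: Castella2018, Thm. 2.3 and §5 (5.1)–(5.3) (arXiv:1704.06608 pp. 5, 12)]
[cite: JetchevSkinnerWan2017, Thm. 3.3.1 and §7.4.1 (arXiv:1512.06894 pp. 11, 30)]
[cite: Hsieh2014, Thm. 1 (arXiv:1112.1580 pp. 3–4)] [cite: GrossZagier1986, Thm. I.6.3 and I.§7] -/
theorem shaFinite_and_indexIdentityAt_of_thmD_OPEN_of_bdpValue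
    (hnf : exists_isNewformOf)
    (hPT : ∀ (K : Type) [Field K] [NumberField K], poitouTate_selmerStructure_duality K)
    (hPT2 : ∀ (K : Type) [Field K] [NumberField K], poitouTate_sha_tateDual K)
    (hH : hsieh2014_exists_anticyclotomicPAdicLFunction)
    (hD : KellerYin2024.thmD_imcMult_exists_isBDPLFunction_isTorsion_charIdeal_eq_OPEN)
    (hGZK : rank_eq_analyticRank_of_analyticRank_le_one)
    (W : WeierstrassCurve ℚ) [W.IsElliptic] [W.IsGloballyMinimal] (p : ℕ) [Fact p.Prime]
    (N : ℕ) [NeZero N] (K : Type) [Field K] [NumberField K]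
    (Dt : ModularParametrizationData W N) (H : HeegnerDatum N (NumberField.discr K))
    (w : InfinitePlace K) (P : (W.baseChange K).toAffine.Point)
    (hGZ : gross_zagier N W K)
    (hp2 : p ≠ 2) (hmult : W.HasMultiplicativeReductionAtPrime p)
    (hred : ¬ W.HasIrreducibleModPGaloisRep p)
    (hr1 : W.analyticRank + (W.quadraticTwist (NumberField.discr K : ℚ)).analyticRank = 1)
    (hN : W.conductorNorm ℤ = N) (hK : IsImaginaryQuadratic K) (hodd : Odd (NumberField.discr K))
    (hlt : NumberField.discr K < -4) (hHN : SatisfiesHeegnerHypothesis N K)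
    (hP : WeierstrassCurve.Affine.Point.map w.embedding.toRatAlgHom P = heegnerPointComplex Dt H)
    (hc : ¬ (p : ℤ) ∣ Dt.c)
    (hval : ∀ (κ : ZpExtension K p), κ.IsAnticyclotomic →
      ∀ (γ : Field.absoluteGaloisGroup K) [Fact (κ.IsTopGenerator γ)]
        (𝔭 : HeightOneSpectrum (𝓞 K)) (h𝔭 : ((p : ℕ) : 𝓞 K) ∈ 𝔭.asIdeal)
        (he : 𝔭.asIdeal.ramificationIdx (𝓞 ℚ) = 1) (hf : 𝔭.asIdeal.inertiaDeg (𝓞 ℚ) = 1),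
        ∀ (ι' : PadicAlgCl p ≃+* ℂ),
          (∀ (w' : InfinitePlace K) (k : 𝓞 K),
            k ∈ 𝔭.asIdeal ↔ ‖ι'.symm (w'.embedding (k : K))‖ < 1) →
          ∀ (ΩK : ℂ) (Ωp : ℂ_[p]) (Q : PowerSeries 𝓞_ℂ_[p]), ΩK ≠ 0 → ‖Ωp‖ = 1 →
            R1.IsBDPLFunctionInt p ι' 𝔭 κ γ Dt.f ΩK Ωp Q →
              R1.BDPValueAtOneIntAt W p (embAt K p 𝔭 h𝔭 he hf) P Q (W.LFunction p)) :
    Finite (W.baseChange K).sha ∧ X11b.IndexIdentityAt W p K P := by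
  have hp : p.Prime := Fact.out
  have hmod : hasEntireLFunction_rat := WeierstrassCurve.hasEntireLFunction_rat_of_exists_isNewformOf hnf
  subst hN
  have hpN : p ∣ W.conductorNorm ℤ := X11b.dvd_conductorNorm_of_mult (W := W) hmult
  have hp2N : ¬ p ^ 2 ∣ W.conductorNorm ℤ := X2.not_sq_dvd_conductorNorm_of_mult W p hmult
  have hHp : SatisfiesHeegnerHypothesis p K := fun ℓ hℓ hℓp ↦
    hHN ℓ hℓ (((Nat.prime_dvd_prime_iff_eq hℓ hp).mp hℓp).symm ▸ hpN)
  have hsp : SplitsIn K p := hHp p hp dvd_rfl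
  have hd3 : NumberField.discr K ≠ -3 := by omega
  have hp2' : 2 < p := lt_of_le_of_ne hp.two_le (Ne.symm hp2)
  -- `ord_{s=1} L(E/K,s) = 1` ⟹ `rank E(K) = 1`, `Ш(E/K)` finite (GZK, both factors), `P` non-torsion (GZ)
  have hEK : analyticRankEK W K = 1 := by rw [analyticRankEK_eq_add_of hmod W K]; exact hr1
  obtain ⟨hrank, hSha⟩ :=
    UniversalToricDescentTwinTorsionRankOneK.mordellWeilRank_eq_one_and_shaFinite_of_analyticRankEK_eq_one
      W hGZK hnf hK.1 hEK
  haveI hfin : Finite (W.baseChange K).sha := hSha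
  haveI hfinp : Finite (AddCommGroup.primaryComponent (W.baseChange K).sha p) :=
    Finite.of_injective _ Subtype.val_injective
  have hPH : IsHeegnerPoint (W.conductorNorm ℤ) W K P := ⟨Dt, H, w.embedding, hP⟩
  have hPinf : ¬ IsOfFinAddOrder P :=
    (lDerivEK_ne_zero_iff_not_isOfFinAddOrder W (W.conductorNorm ℤ) K hGZ hK hHN hPH).mp
      (LDerivEK_ne_zero_of_analyticRankEK_eq_one W K hEK)
  refine ⟨hfin, ?_⟩
  -- Tamagawa transport on a Heegner field with `d_K` odd
  have htamK : padicValNat p (W.baseChange K).tamagawaProduct = 2 * padicValNat p W.tamagawaProduct :=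
    padicValNat_tamagawaProduct_baseChange_of_heegner_odd W p hp2 K hK hodd hHN hHp
  -- the anticyclotomic `ℤ_p`-extension, a topological generator, the two degree-one primes above `p`
  haveI : IsTotallyComplex K := hK.2
  obtain ⟨κ, hκ⟩ := ZpExtension.exists_isAnticyclotomic_holds (K := K) (p := p) hK.1
    (fun w' ↦ IsTotallyComplex.isComplex w')
  obtain ⟨γ, hγ⟩ := κ.surjective (Multiplicative.ofAdd 1)
  haveI : Fact (κ.IsTopGenerator γ) := ⟨hγ⟩
  obtain ⟨𝔭, h𝔭, he, hf⟩ := X11b.exists_degreeOnePrime_of_splitsIn K p hK.1 hsp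
  obtain ⟨-, 𝔭bar, -, hne, h𝔭bar, -⟩ := LocalIndexTransport.exists_conj_prime_of_splitsIn K p hK.1 hsp h𝔭
  obtain ⟨hebar, hfbar⟩ := degreeOne_of_splitsIn hK.1 hsp h𝔭bar
  -- an embedding datum inducing `𝔭`, Hsieh's ♭-frame there (for the newform `Dt.f`), Thm. D at it
  obtain ⟨ι₀⟩ := PadicAlgCl.nonempty_ringEquiv_complex p
  obtain ⟨ι', -, hι'⟩ := X11b.exists_datum_forall_mem_iff p ι₀ hK h𝔭
  obtain ⟨ΩK', Ωp', Q, hΩK', hΩp', hQ⟩ := exists_isBDPLFunctionInt_of_hsieh2014_of_classX2 W p hH ι' 𝔭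
    κ γ Dt.isNewformOf ⟨hp2, hred, hmult⟩ rfl hK hHN h𝔭 hι' hκ hγ
  have hΩp0' : Ωp' ≠ 0 := fun h0 ↦ by rw [h0, norm_zero] at hΩp'; exact zero_ne_one hΩp'
  obtain ⟨-, h3Q⟩ := imcEqIntAt_other_of_thmD_OPEN hD ι' 𝔭 𝔭bar κ γ Dt.isNewformOf rfl hp2' hmult hred
    hK hHN hodd hd3 (hHN p hp hpN) hι' h𝔭bar hne hκ hΩK' hΩp0' hQ
  -- the value at `𝟙` of `Q` (logarithm at `𝔭`)
  have h2Q : R1.BDPValueAtOneIntAt W p (embAt K p 𝔭 h𝔭 he hf) P Q (W.LFunction p) :=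
    hval κ hκ γ 𝔭 h𝔭 he hf ι' hι' ΩK' Ωp' Q hΩK' hΩp' hQ
  -- control at `(𝔭̄, embAt 𝔭̄)` on JSW's inputs (both signs), the logarithm moved from `𝔭` to `𝔭̄`
  have hCTL : ControlOnTreeAt p κ 𝔭bar γ (embAt K p 𝔭bar h𝔭bar hebar hfbar) P :=
    JSWControl.controlOnTreeAt_of_mult_of_rankOne_shaPrimary W p hPT hPT2 hp2 hmult hK hsp hrank hfinp P
      hPinf κ hκ γ 𝔭bar h𝔭bar hebar hfbar
  have hIW : IMCWaldspurgerOnTreeAt p κ 𝔭bar γ (embAt K p 𝔭bar h𝔭bar hebar hfbar) P :=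
    LogSymmetry.imcWaldspurgerOnTreeAt_of_intHalves_of_controlOnTreeAt hCTL h3Q
      (R1.not_dvd_lFunction_of_mult Dt.isNewformOf hmult) h2Q
      (LogSymmetry.padicLogOrd_eq_of_finrank_eq_two W p hp2 hK.1 _ _ hrank P hPinf)
  -- shadow links at `𝔭̄`, then the identity
  obtain ⟨S, hIMC, hBDP, hCTL', hTAM⟩ :=
    exists_shadowLinks_of_onTree_of_heegner p κ 𝔭bar γ (embAt K p 𝔭bar h𝔭bar hebar hfbar) rfl hHN hIW
      hCTL
  exact indexIdentityAt_of_shadowLinks p S hIMC hBDP hCTL' hTAM htamK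


/-! ## §2. The value at `𝟙` FROM PRINT at `p ≥ 5` ([cas-split] Thms. 2.10–2.11) — rank-free -/

/-- **The BDP value at `𝟙` for a ♭-frame, FROM PRINT at `p ≥ 5`** ([cas-split] = Castella, J. Inst. Math.
Jussieu 17 (2018) Thms. 2.10–2.11, tree fact `thm210_thm211_bdpDisplay_pNew`, PUB, either sign at `p`):
for `W/ℚ` globally minimal, `p ≥ 5` multiplicative, `K` imaginary quadratic with `d_K` odd and Heegner for
`N_E`, a datum `Dt` with `p ∤ c(Dt)`, `P` its Heegner point through the infinite place `w` and of INFINITE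
ORDER, an anticyclotomic `(κ, γ)`, a degree-one `𝔭 ∋ p`, an embedding datum `ι′` inducing `𝔭` and a ♭-frame
`(Ω_K ≠ 0, ‖Ω_p‖ = 1, Q)` with `R1.IsBDPLFunctionInt p ι′ 𝔭 κ γ Dt.f Ω_K Ω_p Q`:
`Q(𝟙) = u·((1 − a_p(E) p⁻¹)·log_𝔭 P)²`, `‖u‖ = 1` (`R1.BDPValueAtOneIntAt`). VERBATIM the 20-line block of
crux 4's `Reoriented.bsdp_of_cellC_of_not_split_of_manin_of_pNewValue_of_imcIntOther_of_partner`
(continuity display `continuousDisplay_pNew_of_bdpDisplay` + one-sided value rigidity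
`X11b.intSeries_constantCoeff_eq_of_isBDPLFunctionInt_of_continuousValues`); no rank hypothesis is used.
[cite: Castella2018Exceptional, Thm. 2.10 and Thm. 2.11 (arXiv:1507.04260 pp. 13–14)]
[cite: Castella2018, Thm. 3.2 (arXiv:1704.06608 p. 9)] [cite: BertoliniDarmonPrasanna2013, Thm. 5.13 and §5.2] -/
theorem bdpValueAtOneIntAt_of_bdpDisplay_pNew (hCS : thm210_thm211_bdpDisplay_pNew)
    (W : WeierstrassCurve ℚ) [W.IsElliptic] [W.IsGloballyMinimal] (p : ℕ) [Fact p.Prime]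
    {N : ℕ} [NeZero N] {K : Type} [Field K] [NumberField K]
    (Dt : ModularParametrizationData W N) (H : HeegnerDatum N (NumberField.discr K))
    (w : InfinitePlace K) (P : (W.baseChange K).toAffine.Point)
    (hp5 : 5 ≤ p) (hmult : W.HasMultiplicativeReductionAtPrime p) (hN : W.conductorNorm ℤ = N)
    (hK : IsImaginaryQuadratic K) (hodd : Odd (NumberField.discr K)) (hHN : SatisfiesHeegnerHypothesis N K)
    (hP : WeierstrassCurve.Affine.Point.map w.embedding.toRatAlgHom P = heegnerPointComplex Dt H)
    (hc : ¬ (p : ℤ) ∣ Dt.c) (hPinf : ¬ IsOfFinAddOrder P)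
    (κ : ZpExtension K p) (hκ : κ.IsAnticyclotomic) (γ : Field.absoluteGaloisGroup K)
    [hγ : Fact (κ.IsTopGenerator γ)] (𝔭 : HeightOneSpectrum (𝓞 K)) (h𝔭 : ((p : ℕ) : 𝓞 K) ∈ 𝔭.asIdeal)
    (he : 𝔭.asIdeal.ramificationIdx (𝓞 ℚ) = 1) (hf : 𝔭.asIdeal.inertiaDeg (𝓞 ℚ) = 1)
    (ι' : PadicAlgCl p ≃+* ℂ)
    (hι' : ∀ (w' : InfinitePlace K) (k : 𝓞 K), k ∈ 𝔭.asIdeal ↔ ‖ι'.symm (w'.embedding (k : K))‖ < 1)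
    {ΩK : ℂ} {Ωp : ℂ_[p]} {Q : PowerSeries 𝓞_ℂ_[p]} (hΩK : ΩK ≠ 0) (hΩp : ‖Ωp‖ = 1)
    (hQ : R1.IsBDPLFunctionInt p ι' 𝔭 κ γ Dt.f ΩK Ωp Q) :
    R1.BDPValueAtOneIntAt W p (embAt K p 𝔭 h𝔭 he hf) P Q (W.LFunction p) := by
  have hp : p.Prime := Fact.out
  have hp2 : p ≠ 2 := by omega
  subst hN
  have hpN : p ∣ W.conductorNorm ℤ := X11b.dvd_conductorNorm_of_mult (W := W) hmult
  have hp2N : ¬ p ^ 2 ∣ W.conductorNorm ℤ := X2.not_sq_dvd_conductorNorm_of_mult W p hmult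
  have hΩp0 : Ωp ≠ 0 := fun h0 ↦ by rw [h0, norm_zero] at hΩp; exact zero_ne_one hΩp
  have hemb : ∀ k : 𝓞 K, k ∈ 𝔭.asIdeal ↔ ‖embAt K p 𝔭 h𝔭 he hf (k : K)‖ < 1 :=
    mem_asIdeal_iff_norm_embAt_lt_one 𝔭 h𝔭 he hf
  obtain ⟨ΩK₀, Ωp₀, u₀, hΩK₀, hΩp₀, hu₀, hcont⟩ := continuousDisplay_pNew_of_bdpDisplay hCS ι' W K 𝔭 κ γ
    Dt H w (embAt K p 𝔭 h𝔭 he hf) P hp5 rfl hpN hp2N hK hodd (hHN p hp hpN) h𝔭 hι' hHN hκ hγ.out hc hP hemb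
  have ha : ¬ (p : ℤ) ∣ W.LFunction p := X11b.R1.not_dvd_lFunction_of_mult Dt.isNewformOf hmult
  have hX : algebraMap ℚ_[p] ℂ_[p] (((1 : ℚ_[p]) - ((W.LFunction p : ℤ) : ℚ_[p]) * (p : ℚ_[p])⁻¹) *
      padicLogOmega W p (embAt K p 𝔭 h𝔭 he hf) P) ≠ 0 := by
    rw [map_ne_zero_iff _ (algebraMap ℚ_[p] ℂ_[p]).injective]
    refine mul_ne_zero ?_ ?_
    · intro h0
      have h := X11b.R1.norm_one_sub_div_eq p ha
      rw [h0, norm_zero] at h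
      have hp0 : (0 : ℝ) < p := by exact_mod_cast hp.pos
      exact absurd h (ne_of_lt hp0)
    · rw [← X11b.R1.logOmega_eq_padicLogOmega]
      exact X11b.R1.logOmega_ne_zero W p _ hPinf
  have hu₀0 : u₀ ≠ 0 := fun h0 ↦ by rw [h0, norm_zero] at hu₀; exact zero_ne_one hu₀
  have hc0 : u₀ * (algebraMap ℚ_[p] ℂ_[p] (((1 : ℚ_[p]) - ((W.LFunction p : ℤ) : ℚ_[p]) *
      (p : ℚ_[p])⁻¹) * padicLogOmega W p (embAt K p 𝔭 h𝔭 he hf) P)) ^ 2 ≠ 0 :=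
    mul_ne_zero hu₀0 (pow_ne_zero _ hX)
  have heq := X11b.intSeries_constantCoeff_eq_of_isBDPLFunctionInt_of_continuousValues hp2 hK hκ hγ.out
    hΩK₀ hΩK hΩp₀ hΩp0 hcont hc0 hQ
  refine ⟨u₀, hu₀, ?_⟩
  rw [X11b.R1.logOmega_eq_padicLogOmega, ← heq]
  exact X11b.R1.intSeries_hasValueAt_zero p Q

/-! ## §3. `p ≥ 5`: the identity from Thm. D + PUBLISHED facts (through an infinite place; through any `ι`) -/

/-- **`p ≥ 5`, either sign, either rank orientation: `Ш(E/K)` finite and the Heegner-index identity over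
`K` from Keller–Yin Thm. D BY NAME + PUBLISHED facts** (newforms, Poitou–Tate ×2, Hsieh 2014 Thm. 1,
[cas-split] Thms. 2.10–2.11, Gross–Zagier, GZK), the Heegner point read through an infinite place. §1 with
`hval` discharged by §2 (the value block needs `P` non-torsion, which §1's proof re-derives; here it is
obtained once more from Gross–Zagier). CONDITIONAL; nothing booked. [claim: KellerYin2024, status: under-review]
[cite: KellerYin2024, Thm. D = Thm. 5.1.3 (arXiv:2402.12781v2 L306–L309)]
[cite: Castella2018Exceptional, Thm. 2.10 and Thm. 2.11 (arXiv:1507.04260 pp. 13–14)]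
[cite: Castella2018, Thm. 2.3 and §5 (5.1)–(5.3) (arXiv:1704.06608 pp. 5, 12)] [cite: Hsieh2014, Thm. 1] -/
theorem shaFinite_and_indexIdentityAt_of_thmD_OPEN_pNew
    (hnf : exists_isNewformOf)
    (hPT : ∀ (K : Type) [Field K] [NumberField K], poitouTate_selmerStructure_duality K)
    (hPT2 : ∀ (K : Type) [Field K] [NumberField K], poitouTate_sha_tateDual K)
    (hH : hsieh2014_exists_anticyclotomicPAdicLFunction) (hCS : thm210_thm211_bdpDisplay_pNew)
    (hD : KellerYin2024.thmD_imcMult_exists_isBDPLFunction_isTorsion_charIdeal_eq_OPEN)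
    (hGZK : rank_eq_analyticRank_of_analyticRank_le_one)
    (W : WeierstrassCurve ℚ) [W.IsElliptic] [W.IsGloballyMinimal] (p : ℕ) [Fact p.Prime]
    (N : ℕ) [NeZero N] (K : Type) [Field K] [NumberField K]
    (Dt : ModularParametrizationData W N) (H : HeegnerDatum N (NumberField.discr K))
    (w : InfinitePlace K) (P : (W.baseChange K).toAffine.Point)
    (hGZ : gross_zagier N W K)
    (hp5 : 5 ≤ p) (hmult : W.HasMultiplicativeReductionAtPrime p)
    (hred : ¬ W.HasIrreducibleModPGaloisRep p)
    (hr1 : W.analyticRank + (W.quadraticTwist (NumberField.discr K : ℚ)).analyticRank = 1)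
    (hN : W.conductorNorm ℤ = N) (hK : IsImaginaryQuadratic K) (hodd : Odd (NumberField.discr K))
    (hlt : NumberField.discr K < -4) (hHN : SatisfiesHeegnerHypothesis N K)
    (hP : WeierstrassCurve.Affine.Point.map w.embedding.toRatAlgHom P = heegnerPointComplex Dt H)
    (hc : ¬ (p : ℤ) ∣ Dt.c) :
    Finite (W.baseChange K).sha ∧ X11b.IndexIdentityAt W p K P := by
  have hp2 : p ≠ 2 := by omega
  have hmod : hasEntireLFunction_rat := WeierstrassCurve.hasEntireLFunction_rat_of_exists_isNewformOf hnf
  -- `P` non-torsion (Gross–Zagier on `ord L(E/K) = 1`), for the value block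
  have hEK : analyticRankEK W K = 1 := by rw [analyticRankEK_eq_add_of hmod W K]; exact hr1
  have hPH : IsHeegnerPoint N W K P := ⟨Dt, H, w.embedding, hP⟩
  have hPinf : ¬ IsOfFinAddOrder P :=
    (lDerivEK_ne_zero_iff_not_isOfFinAddOrder W N K hGZ hK hHN hPH).mp
      (LDerivEK_ne_zero_of_analyticRankEK_eq_one W K hEK)
  exact shaFinite_and_indexIdentityAt_of_thmD_OPEN_of_bdpValue hnf hPT hPT2 hH hD hGZK W p N K Dt H w P
    hGZ hp2 hmult hred hr1 hN hK hodd hlt hHN hP hc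
    (fun κ hκ γ _ 𝔭 h𝔭 he hf ι' hι' ΩK Ωp Q hΩK hΩp hQ ↦
      bdpValueAtOneIntAt_of_bdpDisplay_pNew hCS W p Dt H w P hp5 hmult hN hK hodd hHN hP hc hPinf κ hκ γ
        𝔭 h𝔭 he hf ι' hι' hΩK hΩp hQ)

/-- **`p ≥ 5`, the Heegner point read through ANY `ι : K →+* ℂ`** — the binder shape of the route's support
item stmt-BirchSwinnertonDyer-27489 `EisensteinPrimes.HeegnerIndexIdentityKRankOne` (`p ≠ 2`, multiplicative,
`E[p]` reducible, `r_an(E) + r_an(E^{(d_K)}) = 1`, conductor `N`, `K` imaginary quadratic, `d_K` odd `< -4`,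
Heegner for `N`, `P ↦ y_H` through `ι`, `p ∤ c(Dt)`, `Ш(E/K)` finite) PLUS `5 ≤ p`, conclusion
`X11b.IndexIdentityAt W p K P` — from Thm. D BY NAME + PUBLISHED facts. §3 through an infinite place (§0:
`ι = w.embedding ∘ σ`, the identity for `σ_* P`, `[E(K):ℤ·σ_* P] = [E(K):ℤ·P]`). The `Finite Ш(E/K)`
hypothesis of the item is not needed (it is re-derived) but kept for the shape. CONDITIONAL; nothing booked.
[claim: KellerYin2024, status: under-review] [cite: KellerYin2024, Thm. D = Thm. 5.1.3 (arXiv:2402.12781v2 L306–L309)]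
[cite: Castella2018Exceptional, Thm. 2.10 and Thm. 2.11 (arXiv:1507.04260 pp. 13–14)]
[cite: GrossLMS1991, §2 Conj. (2.2) (the identity's shape)] [cite: Castella2018, §5 (5.3) (p. 12)] -/
theorem indexIdentityAt_of_thmD_OPEN_pNew
    (hnf : exists_isNewformOf)
    (hPT : ∀ (K : Type) [Field K] [NumberField K], poitouTate_selmerStructure_duality K)
    (hPT2 : ∀ (K : Type) [Field K] [NumberField K], poitouTate_sha_tateDual K)
    (hH : hsieh2014_exists_anticyclotomicPAdicLFunction) (hCS : thm210_thm211_bdpDisplay_pNew)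
    (hD : KellerYin2024.thmD_imcMult_exists_isBDPLFunction_isTorsion_charIdeal_eq_OPEN)
    (hGZK : rank_eq_analyticRank_of_analyticRank_le_one)
    (hGZall : ∀ (N : ℕ) [NeZero N] (W : WeierstrassCurve ℚ) (K : Type) [Field K] [NumberField K],
      gross_zagier N W K)
    (W : WeierstrassCurve ℚ) [W.IsElliptic] [W.IsGloballyMinimal] (p : ℕ) [Fact p.Prime]
    (N : ℕ) [NeZero N] (K : Type) [Field K] [NumberField K]
    (Dt : ModularParametrizationData W N) (H : HeegnerDatum N (NumberField.discr K)) (ι : K →+* ℂ)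
    (P : (W.baseChange K).toAffine.Point)
    (hp5 : 5 ≤ p) (_hp2 : p ≠ 2) (hmult : W.HasMultiplicativeReductionAtPrime p)
    (hred : ¬ W.HasIrreducibleModPGaloisRep p)
    (hr1 : W.analyticRank + (W.quadraticTwist (NumberField.discr K : ℚ)).analyticRank = 1)
    (hN : W.conductorNorm ℤ = N) (hK : IsImaginaryQuadratic K) (hodd : Odd (NumberField.discr K))
    (hlt : NumberField.discr K < -4) (hHN : SatisfiesHeegnerHypothesis N K)
    (hP : WeierstrassCurve.Affine.Point.map ι.toRatAlgHom P = heegnerPointComplex Dt H)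
    (hc : ¬ (p : ℤ) ∣ Dt.c) (_hfin : Finite (W.baseChange K).sha) :
    X11b.IndexIdentityAt W p K P := by
  obtain ⟨w⟩ := (inferInstance : Nonempty (InfinitePlace K))
  obtain ⟨P', hP', hidx⟩ := exists_point_map_embedding_eq W hK.1 ι w P
  rw [hP] at hP'
  obtain ⟨-, hid⟩ := shaFinite_and_indexIdentityAt_of_thmD_OPEN_pNew hnf hPT hPT2 hH hCS hD hGZK W p N K
    Dt H w P' (hGZall N W K) hp5 hmult hred hr1 hN hK hodd hlt hHN hP' hc
  unfold X11b.IndexIdentityAt at hid ⊢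
  rw [hidx] at hid
  exact hid

end Summit.BirchSwinnertonDyer.BirchSwinnertonDyer.Theorems.EisensteinPrimesMazurMCOnCellBTwistbackThmD

end
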